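import Summits.BirchSwinnertonDyer.BirchSwinnertonDyer.Theses.ErratumRoadFive

/-!
# BC3 birth skeleton — crux child `NonSurjCornerTwinMuAn` of `ErratumRoadFive.NonSurjCorner` (item stmt-BirchSwinnertonDyer-19948; parent 19065,
# K2 rev 21 glued split «CORNER», planner g30) — registered line `Lines/birth.lean`

Authored by corner-p1 g6 (HOME/corner/g6/bc3/NonSurjCornerTwinMuAn_birth.lean, pre-birth form on the Theorems constant);
RETARGETED at birth by planner g30 to conclude the ROUTE decl `Summit.BirchSwinnertonDyer.BirchSwinnertonDyer.Theses.ErratumRoadFive.NonSurjCornerTwinMuAn`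
(`def NonSurjCornerTwinMuAn : Prop := Summit.BirchSwinnertonDyer.BirchSwinnertonDyer.Theorems.NonSurjCornerTwinMuAn` — delta) in the registered shape of record (two named `stub_*`, their
statements by name via `type_of%`, `NonSurjCornerTwinMuAn_of` taking the stub STATEMENTS as hypotheses, `NonSurjCornerTwinMuAn_proof` modulo the
stubs; sorries live only in open `stub_*`). Cut: split by the sign at p: non-split twins (`a = −1`) ∕ split twins (`a = 1`, exceptional zero); BC5: per-pair modular-symbol certificates μ_an = 0 at 5 for 18/18 leaf twins of 3240a1 ∕ 3240d1 ∕ 5780b1 ∕ 5780c1 ∕ 21660j1 ∕ 21660u1 (5S4) and 52345a1 (5Ns) (corner-p1 g6 kit j266579 ∕ j266639 ∕ j266842 ∕ j266844, HOME/corner/g6/CERT-TWINMUAN-5.tsv) — in-Lean rung plan-only (no decidable `IsMultPAdicLFunctionOf` instance yet).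
Nothing is asserted about any curve; this file proves the crux only modulo its stubs (T7).
-/

set_option linter.dupNamespace false
set_option autoImplicit false

namespace Summit.BirchSwinnertonDyer.BirchSwinnertonDyer.Cruxes.NonSurjCornerTwinMuAn.Birth

open CongruenceSubgroup Literature.NumberTheory.EllipticCurves Literature.NumberTheory.EllipticCurves.ModularForms
  Literature.NumberTheory.EllipticCurves.Rank1Residual Summit.BirchSwinnertonDyer.Rank1Residual

/-- **stub (non-split twins)**: a unit coefficient of the Néron-normalised MTT function `ϖ·L` (`a = −1`). -/
theorem stub_twinMuAn_nonsplit :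
    ∀ (Wd : WeierstrassCurve ℚ) [Wd.IsElliptic] [Wd.IsGloballyMinimal] (p : ℕ) [Fact p.Prime],
      ClassX11a Wd p → ¬ Surj Wd p → (p = 5 ∨ p = 7) → p ∣ padicValInt p Wd.minimalDiscriminantInt →
      ¬ Wd.HasSplitMultiplicativeReductionAtPrime p →
      ∀ {N : ℕ} [NeZero N] (f : CuspForm (Gamma0 N) 2), IsNewformOf Wd f →
      ∀ (ϖ : ℚ), (ϖ : ℝ) * Wd.realPeriodRat = plusPeriod f →
      ∀ (L : PowerSeries ℚ_[p]), IsMultPAdicLFunctionOf f p (-1) L →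
        ∃ n : ℕ, ‖PowerSeries.coeff n (PowerSeries.C ((ϖ : ℚ) : ℚ_[p]) * L)‖ = 1 := by
  sorry

/-- **stub (split twins)**: the same for the split function (`a = 1`, exceptional zero at `T = 0`). -/
theorem stub_twinMuAn_split :
    ∀ (Wd : WeierstrassCurve ℚ) [Wd.IsElliptic] [Wd.IsGloballyMinimal] (p : ℕ) [Fact p.Prime],
      ClassX11a Wd p → ¬ Surj Wd p → (p = 5 ∨ p = 7) → p ∣ padicValInt p Wd.minimalDiscriminantInt →
      Wd.HasSplitMultiplicativeReductionAtPrime p →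
      ∀ {N : ℕ} [NeZero N] (f : CuspForm (Gamma0 N) 2), IsNewformOf Wd f →
      ∀ (ϖ : ℚ), (ϖ : ℝ) * Wd.realPeriodRat = plusPeriod f →
      ∀ (L : PowerSeries ℚ_[p]), IsMultPAdicLFunctionOf f p 1 L →
        ∃ n : ℕ, ‖PowerSeries.coeff n (PowerSeries.C ((ϖ : ℚ) : ℚ_[p]) * L)‖ = 1 := by
  sorry

/-! ## Stub statements by name -/

namespace Statement

/-- Statement of `stub_twinMuAn_nonsplit`. -/
abbrev stub_twinMuAn_nonsplit : Prop := type_of% @Birth.stub_twinMuAn_nonsplit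
/-- Statement of `stub_twinMuAn_split`. -/
abbrev stub_twinMuAn_split : Prop := type_of% @Birth.stub_twinMuAn_split

end Statement

/-! ## The composition (sorry-free): the two stub STATEMENTS imply the crux child, BY NAME (route decl) -/

/-- **`NonSurjCornerTwinMuAn_of`** — pure logic (case split), concluding the ROUTE decl. -/
theorem NonSurjCornerTwinMuAn_of (hNs : Statement.stub_twinMuAn_nonsplit) (hSp : Statement.stub_twinMuAn_split) :
    Summit.BirchSwinnertonDyer.BirchSwinnertonDyer.Theses.ErratumRoadFive.NonSurjCornerTwinMuAn := by
  show Summit.BirchSwinnertonDyer.BirchSwinnertonDyer.Theorems.NonSurjCornerTwinMuAn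
  intro Wd _ _ p _ hXa hns h57 hv N _ f hf ϖ hϖ a L hsa hna hL
  by_cases hsplit : Wd.HasSplitMultiplicativeReductionAtPrime p
  · have ha : a = 1 := hsa hsplit
    subst ha
    exact hSp Wd p hXa hns h57 hv hsplit f hf ϖ hϖ L hL
  · have ha : a = -1 := hna hsplit
    subst ha
    exact hNs Wd p hXa hns h57 hv hsplit f hf ϖ hϖ L hL

/-- The crux child along this line, MODULO exactly the two registered stubs (sorries only in open `stub_*`). -/
theorem NonSurjCornerTwinMuAn_proof :
    Summit.BirchSwinnertonDyer.BirchSwinnertonDyer.Theses.ErratumRoadFive.NonSurjCornerTwinMuAn :=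
  NonSurjCornerTwinMuAn_of stub_twinMuAn_nonsplit stub_twinMuAn_split

end Summit.BirchSwinnertonDyer.BirchSwinnertonDyer.Cruxes.NonSurjCornerTwinMuAn.Birth
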